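import Literature.Topology.FourManifolds.KnotTraceOfAttachment
import Literature.Topology.FourManifolds.AttachmentBoundarySurgery
import Literature.Topology.FourManifolds.KnotTraceUniqueness
import Literature.Topology.FourManifolds.PropertyRTraceBridgeOfPropertyR
import HarnessLib

/-!
# The trace bridge T from Property R alone: a `(1,0,1)`-handlebody is a knot trace whose
# boundary is the surgery

Topic `Literature/Topology/FourManifolds`; the last assembly of the residual programme recorded in
`PropertyRTraceBridgeOfPropertyR.lean`, §3: there, the named fact **T**
(`exists_framedKnot_of_hasHandleDecomposition_oneZeroOne`: a compact Morse `(1,0,1)`-handlebody of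
dimension `4` bounds an integral surgery `S³ₙ(K)`, and, if `K` is unknotted with `n = 0`, closes
up with a `(1,1)`-handlebody to the round `S⁴`) was reduced to Property R
(`isUnknot_of_isIntegralSurgery_zero`, Gabai 1987) and ONE handle-theoretic input

  **(P12)** every compact Morse `(1,0,1)`-handlebody `P` is, for every boundary datum `bP`, the
  trace of a framed knot `(K, n)` whose `n`-surgery is `bP.carrier`

(`exists_framedKnot_of_hasHandleDecomposition_oneZeroOne_of_traceSurgery_of_propertyR`).  This file
**proves (P12)** (`traceSurgery_of_hasHandleDecomposition_oneZeroOne`), by Kosinski's handle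
presentation theorem VII (2.2) formalised in `HandleSlab*.lean` / `OneZeroOneHandlebodyAttachment.lean`
(the handlebody **is** `D⁴` with one 2-handle attached), the passage to Kirby traces
(`KnotTraceOfAttachment.lean`), and Kirby's Lemma 2.1 on the boundary
(`AttachmentBoundarySurgery.lean`), packaged first as the general

* `FramedLink.IsTrace.isIntegralSurgery_single` — **the boundary of the trace of a framed knot
  `(K, n)` is the `n`-surgery on `K`** (Kirby 1989, Ch. I §2 Lemma 2.1; Gompf–Stipsicz 1999,
  Prop. 5.1.2), for every boundary datum;

and concludes with

* `exists_framedKnot_of_hasHandleDecomposition_oneZeroOne_of_propertyR` — **T follows from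
  Property R** (Gabai's theorem is the only remaining input of the trace bridge).

Everything here is proved; no named facts are introduced.

## References

* R. C. Kirby, *The Topology of 4-Manifolds*, LNM 1374 (1989), Ch. I §2, Lemma 2.1. [Kirby1989]
* R. E. Gompf, A. I. Stipsicz, *4-Manifolds and Kirby Calculus* (1999), §5.1–5.3. [GompfStipsicz1999]
* A. A. Kosinski, *Differential Manifolds*, Academic Press (1993), VI §6, VII (2.2). [Kosinski1993]
* D. Gabai, *Foliations and the topology of 3-manifolds III*, J. Differential Geom. 26 (1987),
  Cor. 8.3. [GabaiJDG1987]
-/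

open scoped Manifold ContDiff Topology
open Set Function Metric Filter Real

noncomputable section

namespace Literature.Topology.FourManifolds

universe u

attribute [local instance] fact_finrank_euclideanSpace_succ

/-! ### §1 The boundary of a knot trace is the surgery -/

/-- **The boundary of the trace `D⁴ ∪_{(K, n)} h²` of a framed knot is the `n`-surgery on `K`**
(Kirby 1989, Ch. I Lemma 2.1), for every boundary datum `bP` of the trace: the carved ball of a
realization is `D⁴` (`Realization.exists_carvedDiffeomorph`); transporting the 2-handle there, its
values on the unit disc bundle of `T ∩ ∂D⁴` are the oriented tube `ν` of `K` of framing `n`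
(`Realization.carvedEmbed_handle`), and `AttachmentBoundarySurgery.lean` applies.
[cite: Kirby1989, Ch. I §2 Lemma 2.1] [cite: GompfStipsicz1999, §5.3] -/
theorem FramedLink.IsTrace.isIntegralSurgery_single {P : Type u} [TopologicalSpace P]
    [ChartedSpace (EuclideanHalfSpace 4) P] [IsManifold (𝓡∂ 4) ∞ P] {K : Knot} {n : ℤ}
    (h : (FramedLink.single K n).IsTrace P) (bP : BoundaryData (𝓡∂ 4) P (𝓡 3)) :
    IsIntegralSurgery (𝓡 3) bP.carrier K n := by
  obtain ⟨R⟩ := h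
  obtain ⟨E, hE⟩ := R.exists_carvedDiffeomorph
  set g : HandleAttachingMap 3 2 (Metric.closedBall (0 : EuclideanSpace ℝ (Fin 4)) 1) :=
    (R.handle 0).transport E with hg
  have hbd : ∀ y : ↥(handleTube 3 2), tubeDepth y = 0 →
      g.toFun y = (closedBallBoundaryData 3).incl (R.tube 0 (tubeAngle y, tubeFibre y)) :=
    fun y hy => by
    rw [hg, HandleAttachingMap.transport_apply, hE _ (R.handle_mem 0 y), R.carvedEmbed_handle 0 y hy]
  have hP : HandleAttachingMap.IsMultiAttachment (fun j => (R.handle j).transport E) (𝓡∂ 4) P :=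
    R.isMultiAttachment_handle.transport E
  have hfun : (fun j : Fin 1 => (R.handle j).transport E) = fun _ => g :=
    funext fun j => by rw [Fin.fin_one_eq_zero j]
  rw [hfun] at hP
  exact g.isIntegralSurgery_boundary (R.tube 0) hbd hP (R.hasFraming_tube 0) bP

/-! ### §2 (P12) and the trace bridge from Property R -/

/-- **(P12): a compact Morse `(1,0,1)`-handlebody of dimension `4` is, for every boundary datum,
the trace of a framed knot `(K, n)` whose `n`-surgery is that boundary** (Kosinski VII (2.2) +
Kirby I Lemma 2.1). [cite: Kosinski1993, VII (2.2)] [cite: Kirby1989, Ch. I §2 Lemma 2.1] -/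
theorem traceSurgery_of_hasHandleDecomposition_oneZeroOne
    (P : Type) [TopologicalSpace P] [T2Space P] [SecondCountableTopology P]
    [ChartedSpace (EuclideanHalfSpace 4) P] [IsManifold (𝓡∂ 4) ∞ P] [CompactSpace P]
    (hP : HasHandleDecomposition 3 P (fun k => if k = 0 then 1 else if k = 2 then 1 else 0))
    (bP : BoundaryData (𝓡∂ 4) P (𝓡 3)) :
    ∃ (K : Knot) (n : ℤ), IsIntegralSurgery (𝓡 3) bP.carrier K n ∧ (FramedLink.single K n).IsTrace P := by
  obtain ⟨K, n, hT⟩ := exists_isTrace_of_hasHandleDecomposition_oneZeroOne P hP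
  exact ⟨K, n, hT.isIntegralSurgery_single bP, hT⟩

/-- **The trace bridge T from Property R alone**: Gabai's Property R
(`isUnknot_of_isIntegralSurgery_zero`) implies
`exists_framedKnot_of_hasHandleDecomposition_oneZeroOne`. [cite: GabaiJDG1987, Cor. 8.3]
[cite: Kirby1989, Ch. I §2, p. 8 and Lemma 2.1] [cite: Kosinski1993, VII (2.2)] -/
theorem exists_framedKnot_of_hasHandleDecomposition_oneZeroOne_of_propertyR
    (hPR : isUnknot_of_isIntegralSurgery_zero) :
    exists_framedKnot_of_hasHandleDecomposition_oneZeroOne :=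
  exists_framedKnot_of_hasHandleDecomposition_oneZeroOne_of_traceSurgery_of_propertyR
    (fun P _ _ _ _ _ _ hP bP => traceSurgery_of_hasHandleDecomposition_oneZeroOne P hP bP) hPR

end Literature.Topology.FourManifolds
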